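import Literature.Analysis.FluidPDE.GKP2016CriticalElementsPathSpace
import Literature.Analysis.FluidPDE.BesovBlowupCriteriaGKPClass
import Literature.Analysis.FluidPDE.NSCriticalClosureBesovGKPClassProps
import HarnessLib

/-!
# Corollaries of the faithful GKP 2016 Props. 2.1–2.3 (critical elements over GKP's class)

Analysis/FluidPDE proof file (theorems only: no definition, no named fact, no statement changed)
recording how the named facts of `GKP2016CriticalElementsPathSpace.lean` and
`BesovBlowupCriteriaGKPClass.lean` feed the tree's assembly theorems, whose displayed hypotheses
they are:

* `hasSmoothExtensionPast_of_gkp2016_props_pathSpace` — Props. 2.1 + 2.2 + 2.3 (faithful) give the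
  critical Besov continuation criterion `hasSmoothExtensionPast_of_eHomBesovNorm_bounded`
  (`hasSmoothExtensionPast_of_eHomBesovNorm_bounded_of_gkpProps3_gkpClass`, GKP 2016 §2.1
  "Theorem 1 is an immediate corollary of the next three statements").
* `gkp2016_biSup_eq_top_of_props_pathSpace` — the same three facts give Theorem 1 over GKP's class
  in `sup` form for the GKP exponents (`gkpThm1_gkpClass_sup_of_gkpProps_gkpClass`).
* `gkp_rigidity_pathSpace_of_gkp_besov_blowup_pathSpace` — conversely Theorem 1 (faithful,
  `gkp_besov_blowup_pathSpace`) gives Prop. 2.3 (faithful)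
  (`gkp_rigidity_pathSpace_of_blowup_pathSpace`).

## References

* I. Gallagher, G. Koch, F. Planchon, Comm. Math. Phys. 343 (2016) = arXiv:1407.4156, Thm. 1 and
  §2.1 (Props. 2.1–2.3, "Proof of Theorem 1", p. 6). [`GKP2016`]
-/

noncomputable section

open MeasureTheory Set Filter
open _root_.Topology
open scoped SchwartzMap ENNReal NNReal

namespace Literature.Analysis.FluidPDE

/-- **GKP 2016, §2.1: Props. 2.1–2.3 imply the continuation criterion.** With the faithful named
facts as the three inputs of `hasSmoothExtensionPast_of_eHomBesovNorm_bounded_of_gkpProps3_gkpClass`.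
[cite: GKP2016, §2.1 ("Theorem 1 is an immediate corollary of the next three statements", p. 6)] -/
theorem hasSmoothExtensionPast_of_gkp2016_props_pathSpace
    (h1 : gkp_exists_criticalElement_pathSpace) (h2 : gkp_criticalElement_tendsto_zero_pathSpace)
    (h3 : gkp_rigidity_pathSpace) : hasSmoothExtensionPast_of_eHomBesovNorm_bounded :=
  hasSmoothExtensionPast_of_eHomBesovNorm_bounded_of_gkpProps3_gkpClass h1 h2 h3

/-- **GKP 2016, Theorem 1 over GKP's class (`sup` form, GKP exponents) from the faithful
Props. 2.1–2.3**: a maximal GKP solution of the class `(s_p, p, p)`, `p = 3·2^k − 2`, with lifespan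
`0 < T` has `sup_{[0,T)} ‖U t‖_{Ḃ^{s_p}_{p,p}} = ∞`. [cite: GKP2016, Thm. 1 and §2.1 (p. 6)] -/
theorem gkp2016_biSup_eq_top_of_props_pathSpace
    (h1 : gkp_exists_criticalElement_pathSpace) (h2 : gkp_criticalElement_tendsto_zero_pathSpace)
    (h3 : gkp_rigidity_pathSpace) ⦃ν : ℝ⦄ (hν : 0 < ν) ⦃p : ℝ≥0∞⦄ [Fact (1 ≤ p)]
    (hp : IsGKPExponent p) ⦃T : ℝ⦄ (hT : 0 < T)
    ⦃u : ℝ → EuclideanSpace ℝ (Fin 3) → EuclideanSpace ℝ (Fin 3)⦄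
    ⦃U : ℝ → 𝓢'(EuclideanSpace ℝ (Fin 3), EuclideanSpace ℂ (Fin 3))⦄
    (hmax : IsMaximalGKPSolution p p T ν u U) :
    ⨆ t ∈ Ico 0 T, FunctionSpaces.eHomBesovNorm (-1 + 3 / p.toReal) p p (U t) = ∞ :=
  gkpThm1_gkpClass_sup_of_gkpProps_gkpClass h1 h2 h3 hν hp hT hmax

/-- **Prop. 2.3 (faithful) from Theorem 1 (faithful)**: `gkp_besov_blowup_pathSpace` implies
`gkp_rigidity_pathSpace` (`gkp_rigidity_pathSpace_of_blowup_pathSpace`). [cite: GKP2016, Prop. 2.3 and Thm. 1] -/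
theorem gkp_rigidity_pathSpace_of_gkp_besov_blowup_pathSpace (h : gkp_besov_blowup_pathSpace) :
    gkp_rigidity_pathSpace :=
  gkp_rigidity_pathSpace_of_blowup_pathSpace h

/-- Hence Albritton's Theorem 1.1 (faithful) also gives Prop. 2.3 (faithful). [cite: GKP2016, Prop. 2.3] -/
theorem gkp_rigidity_pathSpace_of_albritton_besov_blowup_pathSpace
    (h : albritton_besov_blowup_pathSpace) : gkp_rigidity_pathSpace :=
  gkp_rigidity_pathSpace_of_blowup_pathSpace
    fun _ hν _ _ _ hp₃ hp hq₃ hq _ hT _ _ hmax => (h hν hp₃ hp hq₃ hq hT hmax).limsup_eq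

end Literature.Analysis.FluidPDE

end
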